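import Mathlib.Order.Preorder.Finite
import Mathlib.NumberTheory.PrimesCongruentOne
import Mathlib.Data.Set.Finite.Powerset
import Mathlib.Combinatorics.HalesJewett
import Mathlib.NumberTheory.LSeries.PrimesInAP
import Mathlib.NumberTheory.ArithmeticFunction.Moebius
import Mathlib.Data.ZMod.Basic
import Literature.NumberTheory.LFunctions.LiouvilleNotAutomatic
import HarnessLib

/-!
# The Möbius function is not `k`-automatic — proof of Coons 2010, Theorem 2.8

Proofs file accompanying `Literature/NumberTheory/LFunctions/LiouvilleNotAutomatic.lean`: it
discharges the named fact `coons_moebius_not_automatic` vendored there (M. Coons,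
*(Non)Automaticity of number theoretic functions*, J. Théor. Nombres Bordeaux 22 (2010) 339–352
= arXiv:0810.3709, Theorem 2.8: "The sequence `(μ(n))_{n≥1}` is not `k`-automatic for any
`k ≥ 2`"), in the tree's rendering: `IsKAutomatic k t` = "the `k`-kernel
`{(t(kˡn + r))_{n≥0} : l ≥ 0, 0 ≤ r < kˡ}` of `t` is finite" (Coons's own definition, §1), for
`t = ArithmeticFunction.moebius` (with Mathlib's `μ 0 = 0`, immaterial).

## The printed proof and the proof given here

Coons's proof (§2, proof of Theorem 2.8; arXiv:0810.3709 numbering) is analytic: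
`Σ μ(n) n^{-s} = 1/ζ(s)` has `≍ T log T` poles in the rectangle `R(0,1;T)` (von Mangoldt's count
of the zeros of `ζ`, his Thm 2.7), whereas by Allouche–Mendès France–Peyrière (his Thm 2.1 and
Prop 2.6) the Dirichlet series of a `k`-automatic sequence continues meromorphically to `ℂ` with
poles on finitely many left semi-lattices, hence with `O(T)` poles in any such rectangle.
Neither ingredient is in Mathlib (no Riemann–von Mangoldt formula, no continuation of automatic
Dirichlet series), so this file DEVIATES from the printed road and takes a genuinely shorter one
through another classical theorem on the distribution of primes that Mathlib does provide —
Dirichlet's theorem on primes in arithmetic progressions (`Nat.forall_exists_prime_gt_and_modEq`)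
— proving directly that the `k`-kernel of `μ` is infinite:

* `exists_prime_and_sq_dvd`: if `0 < a`, `r < r'` and `gcd(a, r) = 1`, there is an index `n`
  at which `a n + r` is prime while `a n + r'` is divisible by the square of a prime. (Pick a
  prime `p > a + r'`; solve `a n₀ ≡ -r' (mod p²)`; then `a n₀ + r` is coprime to `a p²` because
  `p ∤ r' - r`, so Dirichlet's theorem gives a prime `a n₀ + r + a p² t`; take `n = n₀ + p² t`.)
* `moebius_progression_ne`: hence `n ↦ μ(a n + r)` and `n ↦ μ(a n + r')` differ (`-1 ≠ 0`).
* `pow_le_card_of_kKernel_moebius_finite`: so the `k^m` kernel elements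
  `n ↦ μ(k^{m+1} n + (k i + 1))`, `i < k^m` (residues `≡ 1 (mod k)`, coprime to `k`), are
  pairwise distinct, and a finite `k`-kernel of `μ` has at least `k^m` elements for every `m`;
* `coons_moebius_not_automatic_holds`: which is absurd for `m` = its cardinality
  (`m < k^m` as `k ≥ 2`).

What is NOT here. The same argument shows that `|μ|` (the indicator of the squarefree numbers,
Coons's `q₂`, his Thm 2.15 for `m = 2`) is not `k`-automatic; it is not vendored. The argument
does NOT give Theorem 1.5 (`λ`, the fact `coons_liouville_not_automatic`), which would need `λ`
to differ somewhere on any two progressions of the same modulus.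
-/

namespace Literature.NumberTheory.LFunctions

/-- **Prime versus square in two progressions of the same modulus.** If `0 < a`, `r < r'` and
`gcd(a, r) = 1`, then at some index `n` the number `a n + r` is prime while `a n + r'` is
divisible by `p²` for a prime `p`. An elementary consequence of Dirichlet's theorem on primes in
arithmetic progressions (Mathlib's `Nat.forall_exists_prime_gt_and_modEq`): with a prime
`p > a + r'` and `n₀` solving `a n₀ ≡ -r' (mod p²)`, the residue `a n₀ + r` is a unit modulo
`a p²` (as `p ∤ r' - r`), and a prime `a n₀ + r + a p² t` in its class does it with
`n = n₀ + p² t`. [folklore] -/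
theorem exists_prime_and_sq_dvd {a r r' : ℕ} (ha : 0 < a) (hrr' : r < r')
    (hcop : Nat.Coprime a r) :
    ∃ n p : ℕ, (a * n + r).Prime ∧ p.Prime ∧ p ^ 2 ∣ a * n + r' := by
  obtain ⟨d, hd⟩ : ∃ d, r' = r + (d + 1) := ⟨r' - r - 1, by omega⟩
  -- a prime `p > a + r'`: it divides neither `a` nor `d + 1 = r' - r`
  obtain ⟨p, hp_ge, hp⟩ := Nat.exists_infinite_primes (a + r' + 1)
  have hpa : Nat.Coprime a p := by
    refine Nat.coprime_comm.mp ((Nat.Prime.coprime_iff_not_dvd hp).mpr fun h => ?_)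
    have := Nat.le_of_dvd ha h
    omega
  have hcop_ap : Nat.Coprime a (p ^ 2) := Nat.Coprime.pow_right 2 hpa
  have hp2 : p ^ 2 ≠ 0 := pow_ne_zero _ hp.ne_zero
  haveI : NeZero (p ^ 2) := ⟨hp2⟩
  -- `n₀` with `p² ∣ a n₀ + r'`, from `a n₀ ≡ -r' (mod p²)` (`a` is a unit modulo `p²`)
  obtain ⟨n₀, hn₀⟩ : ∃ n₀ : ℕ, p ^ 2 ∣ a * n₀ + r' := by
    refine ⟨(-(r' : ZMod (p ^ 2)) * (a : ZMod (p ^ 2))⁻¹).val, ?_⟩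
    rw [← ZMod.natCast_eq_zero_iff, Nat.cast_add, Nat.cast_mul, ZMod.natCast_zmod_val]
    calc (a : ZMod (p ^ 2)) * (-(r' : ZMod (p ^ 2)) * (a : ZMod (p ^ 2))⁻¹) + (r' : ZMod (p ^ 2))
        = -(r' : ZMod (p ^ 2)) * ((a : ZMod (p ^ 2)) * (a : ZMod (p ^ 2))⁻¹)
            + (r' : ZMod (p ^ 2)) := by ring
      _ = 0 := by rw [ZMod.coe_mul_inv_eq_one a hcop_ap]; ring
  -- `a n₀ + r` is coprime to `a p²`
  have hpc : ¬ p ∣ a * n₀ + r := by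
    intro h
    have h' : p ∣ (a * n₀ + r) + (d + 1) := by
      have h'' : p ∣ a * n₀ + r' := (dvd_pow_self p two_ne_zero).trans hn₀
      rwa [hd, ← Nat.add_assoc] at h''
    have hd1 : p ∣ d + 1 := (Nat.dvd_add_right h).mp h'
    have := Nat.le_of_dvd (Nat.succ_pos d) hd1
    omega
  have hcop_c : Nat.Coprime (a * n₀ + r) (a * p ^ 2) := by
    refine Nat.Coprime.mul_right ?_ ?_
    · exact Nat.coprime_comm.mp ((Nat.coprime_mul_left_add_right a r n₀).mpr hcop)
    · exact Nat.Coprime.pow_right 2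
        (Nat.coprime_comm.mp ((Nat.Prime.coprime_iff_not_dvd hp).mpr hpc))
  -- Dirichlet: a prime `P ≡ a n₀ + r (mod a p²)` with `P > a n₀ + r`, i.e. `P = a n₀ + r + a p² t`
  obtain ⟨P, hP_gt, hP, hPmod⟩ :=
    Nat.forall_exists_prime_gt_and_modEq (a * n₀ + r) (mul_ne_zero ha.ne' hp2) hcop_c
  obtain ⟨t, ht⟩ : a * p ^ 2 ∣ P - (a * n₀ + r) := (Nat.modEq_iff_dvd' hP_gt.le).mp hPmod.symm
  have hP_eq : P = a * (n₀ + p ^ 2 * t) + r := by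
    have h1 : P = a * p ^ 2 * t + (a * n₀ + r) := by omega
    rw [h1]; ring
  refine ⟨n₀ + p ^ 2 * t, p, ?_, hp, ?_⟩
  · rw [← hP_eq]; exact hP
  · have h2 : a * (n₀ + p ^ 2 * t) + r' = (a * n₀ + r') + p ^ 2 * (a * t) := by ring
    rw [h2]
    exact dvd_add hn₀ (dvd_mul_right _ _)

/-- **Two progressions of one modulus carry different Möbius sequences.** For `0 < a`, `r < r'`
and `gcd(a, r) = 1`, the sequences `n ↦ μ(a n + r)` and `n ↦ μ(a n + r')` differ: at the index of
`exists_prime_and_sq_dvd` the first value is `μ(prime) = -1` and the second is `0` (a square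
factor). [folklore] -/
theorem moebius_progression_ne {a r r' : ℕ} (ha : 0 < a) (hrr' : r < r')
    (hcop : Nat.Coprime a r) :
    (fun n : ℕ => ArithmeticFunction.moebius (a * n + r)) ≠
      fun n : ℕ => ArithmeticFunction.moebius (a * n + r') := by
  obtain ⟨n, p, hprime, hp, hdvd⟩ := exists_prime_and_sq_dvd ha hrr' hcop
  intro h
  have h1 : ArithmeticFunction.moebius (a * n + r) = ArithmeticFunction.moebius (a * n + r') :=
    congr_fun h n
  rw [ArithmeticFunction.moebius_apply_prime hprime,
    ArithmeticFunction.moebius_eq_zero_of_not_squarefree] at h1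
  · omega
  · intro hsq
    have hunit : IsUnit p := hsq p (by rwa [← pow_two])
    exact hp.one_lt.ne' (Nat.isUnit_iff.mp hunit)

/-- **A finite `k`-kernel of `μ` would have at least `k ^ m` elements, for every `m`** (`k ≥ 2`):
the kernel elements `n ↦ μ(k^{m+1} n + (k i + 1))`, `i < k^m`, are pairwise distinct by
`moebius_progression_ne` (the residues `k i + 1 < k^{m+1}` are coprime to `k`). [folklore] -/
theorem pow_le_card_of_kKernel_moebius_finite {k : ℕ} (hk : 2 ≤ k)
    (hfin : (kKernel k fun n : ℕ => ArithmeticFunction.moebius n).Finite) (m : ℕ) :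
    k ^ m ≤ hfin.toFinset.card := by
  have hk0 : 0 < k ^ (m + 1) := pow_pos (by omega) _
  have hcopk : ∀ i : ℕ, Nat.Coprime (k ^ (m + 1)) (k * i + 1) := fun i =>
    Nat.Coprime.pow_left (m + 1)
      ((Nat.coprime_mul_left_add_right k 1 i).mpr (Nat.coprime_one_right k))
  have hmono : ∀ {i j : ℕ}, i < j → k * i + 1 < k * j + 1 := fun {i j} h => by
    have h1 : k * (i + 1) ≤ k * j := Nat.mul_le_mul_left k h
    have h2 : k * (i + 1) = k * i + k := by ring
    omega
  have key : (Finset.range (k ^ m)).card ≤ hfin.toFinset.card := by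
    refine Finset.card_le_card_of_injOn
      (fun i : ℕ => fun n : ℕ => ArithmeticFunction.moebius (k ^ (m + 1) * n + (k * i + 1)))
      ?_ ?_
    · intro i hi
      have hi' : i < k ^ m := by simpa using hi
      rw [Finset.mem_coe, Set.Finite.mem_toFinset]
      refine ⟨m + 1, k * i + 1, ?_, rfl⟩
      have h1 : k * (i + 1) ≤ k * k ^ m := Nat.mul_le_mul_left k hi'
      have h2 : k * (i + 1) = k * i + k := by ring
      have h3 : k ^ (m + 1) = k * k ^ m := by ring
      omega
    · intro i _ j _ hij
      by_contra hne
      rcases lt_or_gt_of_ne hne with h | h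
      · exact moebius_progression_ne hk0 (hmono h) (hcopk i) hij
      · exact moebius_progression_ne hk0 (hmono h) (hcopk j) hij.symm
  simpa using key

/-- **Coons 2010, Theorem 2.8, PROVED** (discharge of the named fact
`coons_moebius_not_automatic`): "The sequence `(μ(n))_{n≥1}` is not `k`-automatic for any
`k ≥ 2`" — for every `k ≥ 2` the `k`-kernel of `μ = ArithmeticFunction.moebius` is infinite.
The formal proof is not Coons's analytic one (poles of `1/ζ` counted by von Mangoldt's theorem
against the Allouche–Mendès France–Peyrière meromorphy of automatic Dirichlet series, neither of
which Mathlib has) but the elementary one of this file via Dirichlet's theorem on primes in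
arithmetic progressions: by `pow_le_card_of_kKernel_moebius_finite` a finite kernel with `c`
elements would satisfy `k ^ c ≤ c < k ^ c`. [cite: Coons2011, Theorem 2.8] -/
theorem coons_moebius_not_automatic_holds : coons_moebius_not_automatic := by
  intro k hk hfin
  have hfin' : (kKernel k fun n : ℕ => ArithmeticFunction.moebius n).Finite := hfin
  have h1 := pow_le_card_of_kKernel_moebius_finite hk hfin' hfin'.toFinset.card
  have h2 : hfin'.toFinset.card < k ^ hfin'.toFinset.card := Nat.lt_pow_self hk
  omega

end Literature.NumberTheory.LFunctions

/-!
# Part 2. Liouville's function is not `k`-automatic (Coons 2010, Theorem 1.5) — proof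

This second part of the file (appended 2026-08-15; independent of Part 1 above) discharges the
named fact `Literature.NumberTheory.LFunctions.coons_liouville_not_automatic` (M. Coons, *(Non)Automaticity
of number theoretic functions*, J. Théor. Nombres Bordeaux **22** (2010) 339–352, Theorem 1.5,
first clause): for every `k ≥ 2` the `k`-kernel of `λ` is infinite.

## The proof formalised here

Coons's printed proof is analytic (`Σ λ(n) n^{-s} = ζ(2s)/ζ(s)` has `≍ T log T` poles on
`Re s = 1/2` up to height `T` by Selberg's positive-proportion theorem, versus the `O(T)` poles of
the meromorphic continuation of an automatic Dirichlet series, Allouche–Mendès France–Peyrière);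
none of these inputs is available in Mathlib. We give instead an ELEMENTARY proof whose
combinatorial core is the first half of the proof of Proposition 1 of J.-C. Schlage-Puchta,
*Completely multiplicative automatic functions*, Integers **11** (2011) A31 (van der Waerden's
theorem on the states of the automaton, division by the common difference using complete
multiplicativity, and pumping through the "states reachable in exactly `n` steps"), followed by a
short Liouville-specific ending replacing Schlage-Puchta's appeal to the Wirsing–Halász mean value
theorem. Everything is phrased for a sequence `t : ℕ → ℤ` with values in `{1, -1, 0}`, completely
multiplicative, non-vanishing on `n ≥ 1` and equal to `-1` at every prime (so `t = λ`), in kernel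
language (no automata are introduced):

1. *Reach periodicity.* For `R ⊆ S` (the kernel) let `Φ R = {n ↦ f (k n + d) : f ∈ R, d < k}`.
   Since `S` is finite, pigeonhole on `n ↦ {(B, g) : B ∈ S, g ∈ Φ^[n] {B}} ⊆ S × S` gives
   `T` and `P > 0` with `Φ^[T + yP] {B} = Φ^[T] {B}` for all `B ∈ S`, `y`; and
   `Φ^[n] {m ↦ t(k^l m + r)} = {m ↦ t(k^{l+n} m + k^l j + r) : j < k^n}`.
2. *van der Waerden* (Mathlib's `Combinatorics.exists_mono_homothetic_copy`) applied to the finite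
   colouring `n ↦ ({f ∈ S : f n = 1}, {f ∈ S : f n = -1})` yields `A` and `D > 0` with
   `f (A + D i) = f A` for all `f ∈ S` and `i ≤ 2 k^T`.
3. *Division* (`t` completely multiplicative): with `D ≤ k^e`, `b₀ < D`, `D ∣ k^e A + b₀`,
   `k^e A + b₀ = D a₀`, one gets `t(a₀ + k^e i) = t(a₀) =: c₀ ≠ 0` for `i ≤ 2k^T`; writing
   `a₀ = k^e (k^T U + V) + W` this contains a full aligned block:
   `t(k^{e+T} (U+1) + k^e j + W) = c₀` for all `j < k^T`.
4. *Pumping* (1): `t(k^{e+T+yP} (U+1) + k^e j + W) = c₀` for all `y` and all `j < k^{T+yP}`.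
5. *Ending.* Let `p ≡ 1 (mod k^e)` be prime (`Nat.exists_prime_gt_modEq_one`),
   `n₁ = k^{e+T} (U+1) + W`. For `X = k^{e+T+yP} ≥ 16 p n₁ k^{2e} (U+1)` there is
   `s ≡ 1 (mod k^e)` with `(U+1) X ≤ p n₁ s² < (U+2) X`; then `p n₁ s² ≡ W (mod k^e)` lies in the
   pumped block, so `t(p n₁ s²) = c₀`, while complete multiplicativity gives `t(p n₁ s²) = -c₀`.

All auxiliary statements live in the sub-namespace `CoonsLiouville` and are proved here; no
definitions and no named facts are introduced (the step map `Φ` is carried as a hypothesis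
`hΦ : ∀ R, Φ R = …`).

## References (Part 2)

* M. Coons, *(Non)Automaticity of number theoretic functions*, JTNB 22 (2010), Thm 1.5. [Coons2011]
* J.-C. Schlage-Puchta, *Completely multiplicative automatic functions*, Integers 11 (2011), A31,
  Proposition 1 and its proof. [SchlagePuchta2011]
* J.-P. Allouche, J. Shallit, *Automatic Sequences*, CUP 2003, §6.6 (kernels). [AlloucheShallit2003]
-/

namespace Literature.NumberTheory.LFunctions

namespace CoonsLiouville

/-! ### Kernel elements, decimation, reach sets -/

/-- `n ↦ t(k^l n + r)` lies in the `k`-kernel of `t` when `r < k^l`. [cite: Coons2011, §1] -/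
theorem kerElt_mem {k : ℕ} (t : ℕ → ℤ) {l r : ℕ} (hr : r < k ^ l) :
    (fun n => t (k ^ l * n + r)) ∈ kKernel k t :=
  ⟨l, r, hr, rfl⟩

/-- The `d`-th `k`-decimation of the kernel element `(l, r)` is the kernel element
`(l + 1, k^l d + r)`. [cite: AlloucheShallit2003, §6.6] -/
theorem decim_kerElt (k : ℕ) (t : ℕ → ℤ) (l r d : ℕ) :
    (fun n => t (k ^ l * (k * n + d) + r)) = fun n => t (k ^ (l + 1) * n + (k ^ l * d + r)) := by
  funext n
  congr 1
  ring

/-- Index bound for decimated kernel elements: `k^l d + r < k^{l+1}` for `d < k`, `r < k^l`.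
[folklore] -/
theorem decim_index_lt {k l r d : ℕ} (hd : d < k) (hr : r < k ^ l) :
    k ^ l * d + r < k ^ (l + 1) :=
  calc k ^ l * d + r < k ^ l * d + k ^ l := by omega
    _ = k ^ l * (d + 1) := by ring
    _ ≤ k ^ l * k := Nat.mul_le_mul_left _ hd
    _ = k ^ (l + 1) := (pow_succ k l).symm

/-- The kernel is closed under the step map `Φ R = {n ↦ f (k n + d) : f ∈ R, d < k}`.
[cite: AlloucheShallit2003, §6.6] -/
theorem step_subset_kKernel {k : ℕ} {t : ℕ → ℤ} {Φ : Set (ℕ → ℤ) → Set (ℕ → ℤ)}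
    (hΦ : ∀ R, Φ R = {g | ∃ f ∈ R, ∃ d < k, g = fun n => f (k * n + d)})
    {R : Set (ℕ → ℤ)} (hR : R ⊆ kKernel k t) : Φ R ⊆ kKernel k t := by
  intro g hg
  rw [hΦ] at hg
  obtain ⟨f, hf, d, hd, rfl⟩ := hg
  obtain ⟨l, r, hr, rfl⟩ := hR hf
  refine ⟨l + 1, k ^ l * d + r, decim_index_lt hd hr, ?_⟩
  funext n
  show t (k ^ l * (k * n + d) + r) = t (k ^ (l + 1) * n + (k ^ l * d + r))
  congr 1
  ring

/-- Iterates of the step map stay inside the kernel. [cite: AlloucheShallit2003, §6.6] -/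
theorem iterate_step_subset_kKernel {k : ℕ} {t : ℕ → ℤ} {Φ : Set (ℕ → ℤ) → Set (ℕ → ℤ)}
    (hΦ : ∀ R, Φ R = {g | ∃ f ∈ R, ∃ d < k, g = fun n => f (k * n + d)})
    (n : ℕ) {R : Set (ℕ → ℤ)} (hR : R ⊆ kKernel k t) : Φ^[n] R ⊆ kKernel k t := by
  induction n with
  | zero => simpa using hR
  | succ n ih =>
    rw [Function.iterate_succ_apply']
    exact step_subset_kKernel hΦ ih

/-- The elements reachable from `m ↦ t(k^l m + r)` in exactly `n` steps are the
`m ↦ t(k^{l+n} m + k^l j + r)`, `j < k^n` ("reading `n` more digits").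
[cite: SchlagePuchta2011, proof of Proposition 1] -/
theorem iterate_step_singleton {k : ℕ} (hk : 0 < k) (t : ℕ → ℤ)
    {Φ : Set (ℕ → ℤ) → Set (ℕ → ℤ)}
    (hΦ : ∀ R, Φ R = {g | ∃ f ∈ R, ∃ d < k, g = fun n => f (k * n + d)}) (l r n : ℕ) :
    Φ^[n] {fun m => t (k ^ l * m + r)} =
      {g | ∃ j < k ^ n, g = fun m => t (k ^ (l + n) * m + (k ^ l * j + r))} := by
  induction n with
  | zero =>
    ext g
    simp
  | succ n ih =>
    rw [Function.iterate_succ_apply', ih, hΦ]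
    ext g
    simp only [Set.mem_setOf_eq]
    constructor
    · rintro ⟨f, ⟨j, hj, rfl⟩, d, hd, rfl⟩
      refine ⟨k ^ n * d + j, decim_index_lt hd hj, ?_⟩
      funext m
      show t (k ^ (l + n) * (k * m + d) + (k ^ l * j + r)) =
        t (k ^ (l + (n + 1)) * m + (k ^ l * (k ^ n * d + j) + r))
      congr 1
      ring
    · rintro ⟨j, hj, rfl⟩
      have hkn : 0 < k ^ n := pow_pos hk n
      refine ⟨fun m => t (k ^ (l + n) * m + (k ^ l * (j % k ^ n) + r)),
        ⟨j % k ^ n, Nat.mod_lt _ hkn, rfl⟩, j / k ^ n, ?_, ?_⟩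
      · rw [Nat.div_lt_iff_lt_mul hkn]
        calc j < k ^ (n + 1) := hj
          _ = k * k ^ n := pow_succ' k n
      · funext m
        show t (k ^ (l + (n + 1)) * m + (k ^ l * j + r)) =
          t (k ^ (l + n) * (k * m + j / k ^ n) + (k ^ l * (j % k ^ n) + r))
        congr 1
        conv_lhs => rw [← Nat.div_add_mod j (k ^ n)]
        ring

/-- **Reach periodicity** (finite kernel): there are `T` and `P > 0` such that the set of kernel
elements reachable from any `B ∈ S` in exactly `T + yP` steps does not depend on `y`.
[cite: SchlagePuchta2011, proof of Proposition 1] -/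
theorem exists_period {k : ℕ} {t : ℕ → ℤ} {Φ : Set (ℕ → ℤ) → Set (ℕ → ℤ)}
    (hΦ : ∀ R, Φ R = {g | ∃ f ∈ R, ∃ d < k, g = fun n => f (k * n + d)})
    (hS : (kKernel k t).Finite) :
    ∃ T P : ℕ, 0 < P ∧ ∀ B ∈ kKernel k t, ∀ y : ℕ, Φ^[T + y * P] {B} = Φ^[T] {B} := by
  set S := kKernel k t with hSdef
  let F : ℕ → Set ((ℕ → ℤ) × (ℕ → ℤ)) := fun n => {q | q.1 ∈ S ∧ q.2 ∈ Φ^[n] {q.1}}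
  have hF : ∀ n, F n ∈ {R : Set ((ℕ → ℤ) × (ℕ → ℤ)) | R ⊆ S ×ˢ S} := by
    intro n
    simp only [Set.mem_setOf_eq]
    intro q hq
    exact ⟨hq.1, iterate_step_subset_kKernel hΦ n (Set.singleton_subset_iff.mpr hq.1) hq.2⟩
  obtain ⟨a, b, hab, hFab⟩ :=
    Set.Finite.exists_lt_map_eq_of_forall_mem hF (hS.prod hS).finite_subsets
  obtain ⟨c, hc⟩ := Nat.exists_eq_add_of_le hab.le
  have key : ∀ B ∈ S, Φ^[a + c] {B} = Φ^[a] {B} := by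
    intro B hB
    rw [← hc]
    ext g
    have h : (B, g) ∈ F a ↔ (B, g) ∈ F b := by rw [hFab]
    simp only [F, Set.mem_setOf_eq, hB, true_and] at h
    exact h.symm
  refine ⟨a, c, by omega, fun B hB y => ?_⟩
  induction y with
  | zero => simp
  | succ y ih =>
    have e1 : a + (y + 1) * c = y * c + (a + c) := by ring
    rw [e1, Function.iterate_add_apply, key B hB, ← Function.iterate_add_apply,
      Nat.add_comm (y * c) a]
    exact ih

/-! ### van der Waerden on kernel columns -/

/-- **A long progression of equal kernel columns** (van der Waerden): if `t` takes values in
`{1, -1, 0}` and has finite `k`-kernel then for every `N` there are `A` and `D > 0` with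
`f (A + D i) = f A` for every kernel element `f` and every `i ≤ N`.
[cite: SchlagePuchta2011, proof of Proposition 1] -/
theorem exists_ap {k : ℕ} {t : ℕ → ℤ} (ht : ∀ n, t n = 1 ∨ t n = -1 ∨ t n = 0)
    (hS : (kKernel k t).Finite) (N : ℕ) :
    ∃ A D : ℕ, 0 < D ∧ ∀ f ∈ kKernel k t, ∀ i ≤ N, f (A + D * i) = f A := by
  set S := kKernel k t with hSdef
  have hfin : {R : Set (ℕ → ℤ) | R ⊆ S}.Finite := hS.finite_subsets
  haveI : Finite {R : Set (ℕ → ℤ) | R ⊆ S} := hfin.to_subtype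
  let C : ℕ → {R : Set (ℕ → ℤ) | R ⊆ S} × {R : Set (ℕ → ℤ) | R ⊆ S} := fun n =>
    (⟨{f | f ∈ S ∧ f n = 1}, fun f hf => hf.1⟩, ⟨{f | f ∈ S ∧ f n = -1}, fun f hf => hf.1⟩)
  obtain ⟨D, hD, A, c, hc⟩ :=
    Combinatorics.exists_mono_homothetic_copy (Finset.range (N + 1)) C
  refine ⟨A, D, hD, fun f hf i hi => ?_⟩
  have h0 : C A = c := by simpa using hc 0 (by simp)
  have hi' : C (D * i + A) = c := by
    simpa using hc i (Finset.mem_range.mpr (Nat.lt_succ_of_le hi))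
  have hAC : C A = C (D * i + A) := h0.trans hi'.symm
  have h1 : f A = 1 ↔ f (D * i + A) = 1 := by
    have := congrArg (fun x => f ∈ (x.1 : Set (ℕ → ℤ))) hAC
    simpa [C, hf] using this
  have h2 : f A = -1 ↔ f (D * i + A) = -1 := by
    have := congrArg (fun x => f ∈ (x.2 : Set (ℕ → ℤ))) hAC
    simpa [C, hf] using this
  rw [show A + D * i = D * i + A from Nat.add_comm _ _]
  obtain ⟨l, r, -, rfl⟩ := hf
  simp only at h1 h2 ⊢
  rcases ht (k ^ l * A + r) with h | h | h
  · rw [h, h1.mp h]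
  · rw [h, h2.mp h]
  · rcases ht (k ^ l * (D * i + A) + r) with h' | h' | h'
    · exact absurd (h1.mpr h') (by rw [h]; norm_num)
    · exact absurd (h2.mpr h') (by rw [h]; norm_num)
    · rw [h, h']

/-! ### The square lemma used in the ending -/

/-- For `X ≥ 16 g m² u` there is `s ≡ 1 (mod m)` with `u X ≤ g s² < (u + 1) X`. [folklore] -/
theorem exists_sq_between (g m u X : ℕ) (hg : 1 ≤ g) (hm : 1 ≤ m) (hu : 1 ≤ u)
    (hX : 16 * g * m ^ 2 * u ≤ X) :
    ∃ s : ℕ, s % m = 1 % m ∧ u * X ≤ g * s ^ 2 ∧ g * s ^ 2 < (u + 1) * X := by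
  classical
  have hg0 : 0 < g := hg
  have hm0 : 0 < m := hm
  have hu0 : 0 < u := hu
  have hm2 : 0 < m ^ 2 := by positivity
  have h16 : 16 * g ≤ 16 * g * m ^ 2 * u :=
    le_trans (Nat.le_mul_of_pos_right _ hm2) (Nat.le_mul_of_pos_right _ hu0)
  have huX : u ≤ X := by
    have : u ≤ 16 * g * m ^ 2 * u := Nat.le_mul_of_pos_left u (by positivity)
    omega
  have hP : ∃ t, u * X ≤ g * (1 + m * t) ^ 2 := by
    refine ⟨X, ?_⟩
    have hXm : X ≤ m * X := Nat.le_mul_of_pos_left X hm0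
    calc u * X ≤ X * X := Nat.mul_le_mul_right X huX
      _ ≤ (m * X) * (m * X) := Nat.mul_le_mul hXm hXm
      _ ≤ (1 + m * X) * (1 + m * X) :=
          Nat.mul_le_mul (Nat.le_add_left _ _) (Nat.le_add_left _ _)
      _ = (1 + m * X) ^ 2 := (sq _).symm
      _ ≤ g * (1 + m * X) ^ 2 := Nat.le_mul_of_pos_left _ hg0
  obtain ⟨t₀, ht₀, hmin⟩ : ∃ t₀, u * X ≤ g * (1 + m * t₀) ^ 2 ∧
      ∀ t < t₀, ¬ u * X ≤ g * (1 + m * t) ^ 2 :=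
    ⟨Nat.find hP, Nat.find_spec hP, fun t ht => Nat.find_min hP ht⟩
  have ht₀pos : t₀ ≠ 0 := by
    intro h0
    rw [h0, mul_zero, add_zero, one_pow, mul_one] at ht₀
    have h2 : X ≤ u * X := Nat.le_mul_of_pos_left X hu0
    omega
  obtain ⟨t₁, rfl⟩ : ∃ t₁, t₀ = t₁ + 1 := ⟨t₀ - 1, by omega⟩
  have hlt : g * (1 + m * t₁) ^ 2 < u * X := Nat.lt_of_not_le (hmin t₁ (Nat.lt_succ_self t₁))
  refine ⟨1 + m * (t₁ + 1), by rw [Nat.add_mul_mod_self_left], ht₀, ?_⟩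
  have h4 : 4 * g * m * (1 + m * t₁) < X := by
    have h1 : (4 * g * m * (1 + m * t₁)) ^ 2 < X ^ 2 := by
      calc (4 * g * m * (1 + m * t₁)) ^ 2 = 16 * g * m ^ 2 * (g * (1 + m * t₁) ^ 2) := by ring
        _ < 16 * g * m ^ 2 * (u * X) := (Nat.mul_lt_mul_left (by positivity)).mpr hlt
        _ = (16 * g * m ^ 2 * u) * X := by ring
        _ ≤ X * X := Nat.mul_le_mul_right X hX
        _ = X ^ 2 := (sq X).symm
    exact lt_of_pow_lt_pow_left₀ 2 (Nat.zero_le _) h1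
  have h5 : 2 * g * m ^ 2 ≤ X := by
    have : 2 * g * m ^ 2 ≤ 16 * g * m ^ 2 * u :=
      le_trans (Nat.mul_le_mul_right _ (Nat.mul_le_mul_right g (by norm_num)))
        (Nat.le_mul_of_pos_right _ hu0)
    omega
  nlinarith [hlt, h4, h5]

/-! ### The main theorem -/

/-- **No completely multiplicative `{±1}`-valued sequence with `t(p) = -1` at every prime is
`k`-automatic** (`k ≥ 2`): the `k`-kernel of such a `t` (with `t 0` arbitrary in `{1,-1,0}`,
forced to be `0`) is infinite. This is Coons's Theorem 1.5 for `t = λ`, by the elementary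
argument described in the module docstring. [cite: Coons2011, Theorem 1.5] -/
theorem not_isKAutomatic_of_apply_prime {k : ℕ} (hk : 2 ≤ k) {t : ℕ → ℤ}
    (ht : ∀ n, t n = 1 ∨ t n = -1 ∨ t n = 0) (hne : ∀ n, n ≠ 0 → t n ≠ 0)
    (hmul : ∀ m n, t (m * n) = t m * t n) (hprime : ∀ p, p.Prime → t p = -1) :
    ¬ IsKAutomatic k t := by
  intro hS
  change (kKernel k t).Finite at hS
  have hk0 : 0 < k := by omega
  have hk1 : 1 < k := by omega
  have ht0 : t 0 = 0 := by
    have h := hmul 0 2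
    rw [zero_mul, hprime 2 Nat.prime_two] at h
    omega
  have hsq : ∀ s, s ≠ 0 → t (s ^ 2) = 1 := by
    intro s hs
    rw [sq, hmul]
    rcases ht s with h | h | h
    · simp [h]
    · simp [h]
    · exact absurd h (hne s hs)
  obtain ⟨Φ, hΦ⟩ : ∃ Φ : Set (ℕ → ℤ) → Set (ℕ → ℤ),
      ∀ R, Φ R = {g | ∃ f ∈ R, ∃ d < k, g = fun n => f (k * n + d)} := ⟨_, fun R => rfl⟩
  -- (1) reach periodicity, (2) van der Waerden
  obtain ⟨T, P, hP, hper⟩ := exists_period hΦ hS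
  obtain ⟨A, D, hD, hAP⟩ := exists_ap ht hS (2 * k ^ T)
  have hkT : 0 < k ^ T := pow_pos hk0 T
  -- (3) division by `D`
  obtain ⟨e, he1, hDe⟩ : ∃ e : ℕ, 1 ≤ e ∧ D ≤ k ^ e := ⟨D, hD, (Nat.lt_pow_self hk1).le⟩
  have hke : 0 < k ^ e := pow_pos hk0 e
  obtain ⟨b₀, hb₀D, hdvd⟩ : ∃ b₀ < D, D ∣ k ^ e * A + b₀ := by
    by_cases hx : k ^ e * A % D = 0
    · exact ⟨0, hD, by simpa [Nat.dvd_iff_mod_eq_zero] using hx⟩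
    · refine ⟨D - k ^ e * A % D, Nat.sub_lt hD (Nat.pos_of_ne_zero hx), k ^ e * A / D + 1, ?_⟩
      have h := Nat.div_add_mod (k ^ e * A) D
      have hlt : k ^ e * A % D < D := Nat.mod_lt _ hD
      calc k ^ e * A + (D - k ^ e * A % D)
          = D * (k ^ e * A / D) + k ^ e * A % D + (D - k ^ e * A % D) := by rw [h]
        _ = D * (k ^ e * A / D) + (k ^ e * A % D + (D - k ^ e * A % D)) := by rw [add_assoc]
        _ = D * (k ^ e * A / D) + D := by rw [Nat.add_sub_cancel' hlt.le]
        _ = D * (k ^ e * A / D + 1) := by ring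
  have hb₀e : b₀ < k ^ e := lt_of_lt_of_le hb₀D hDe
  obtain ⟨a₀, ha₀D⟩ : ∃ a₀, k ^ e * A + b₀ = D * a₀ := hdvd
  have hAPl : ∀ i ≤ 2 * k ^ T, t (a₀ + k ^ e * i) = t a₀ := by
    intro i hi
    have h := hAP _ (kerElt_mem t hb₀e) i hi
    have e1 : k ^ e * (A + D * i) + b₀ = D * (a₀ + k ^ e * i) := by
      rw [mul_add D a₀, ← ha₀D]; ring
    rw [e1, ha₀D, hmul, hmul] at h
    exact mul_left_cancel₀ (hne D hD.ne') h
  have h2kT : 1 ≤ 2 * k ^ T := by omega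
  have ha₀0 : a₀ ≠ 0 := by
    intro h0
    have h := hAPl 1 h2kT
    rw [h0, zero_add, mul_one, ht0] at h
    exact hne _ hke.ne' h
  obtain ⟨c₀, hc₀def⟩ : ∃ c₀, t a₀ = c₀ := ⟨_, rfl⟩
  have hc₀ : c₀ ≠ 0 := hc₀def ▸ hne a₀ ha₀0
  -- alignment: a full aligned block
  obtain ⟨W, hWdef⟩ : ∃ W, W = a₀ % k ^ e := ⟨_, rfl⟩
  obtain ⟨a₁, ha₁def⟩ : ∃ a₁, a₁ = a₀ / k ^ e := ⟨_, rfl⟩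
  obtain ⟨V, hVdef⟩ : ∃ V, V = a₁ % k ^ T := ⟨_, rfl⟩
  obtain ⟨U, hUdef⟩ : ∃ U, U = a₁ / k ^ T := ⟨_, rfl⟩
  have hW : W < k ^ e := hWdef ▸ Nat.mod_lt _ hke
  have hV : V < k ^ T := hVdef ▸ Nat.mod_lt _ hkT
  have ha₀eq : a₀ = k ^ e * a₁ + W := by
    rw [hWdef, ha₁def]; exact (Nat.div_add_mod a₀ (k ^ e)).symm
  have ha₁eq : a₁ = k ^ T * U + V := by
    rw [hVdef, hUdef]; exact (Nat.div_add_mod a₁ (k ^ T)).symm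
  have hblock : ∀ j < k ^ T, t (k ^ (e + T) * (U + 1) + (k ^ e * j + W)) = c₀ := by
    intro j hj
    have h := hAPl (k ^ T - V + j) (by omega)
    obtain ⟨Z, hZ⟩ := Nat.exists_eq_add_of_le hV.le
    have eq : a₀ + k ^ e * (k ^ T - V + j) = k ^ (e + T) * (U + 1) + (k ^ e * j + W) := by
      rw [show k ^ T - V = Z by omega, ha₀eq, ha₁eq, pow_add, hZ]
      ring
    rw [← eq, ← hc₀def]
    exact h
  -- (4) pumping
  have hblock' : ∀ g ∈ Φ^[T] {fun m => t (k ^ e * m + W)}, g (U + 1) = c₀ := by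
    intro g hg
    rw [iterate_step_singleton hk0 t hΦ] at hg
    obtain ⟨j, hj, rfl⟩ := hg
    exact hblock j hj
  have hpump : ∀ y : ℕ, ∀ j < k ^ (T + y * P),
      t (k ^ (e + (T + y * P)) * (U + 1) + (k ^ e * j + W)) = c₀ := by
    intro y j hj
    have hmem : (fun m => t (k ^ (e + (T + y * P)) * m + (k ^ e * j + W))) ∈
        Φ^[T + y * P] {fun m => t (k ^ e * m + W)} := by
      rw [iterate_step_singleton hk0 t hΦ]
      exact ⟨j, hj, rfl⟩
    rw [hper _ (kerElt_mem t hW) y] at hmem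
    exact hblock' _ hmem
  -- (5) the ending
  have hm2 : 2 ≤ k ^ e := le_trans hk (Nat.le_self_pow (by omega) k)
  obtain ⟨p, hp, -, hpmod⟩ := Nat.exists_prime_gt_modEq_one 0 (by omega : k ^ e ≠ 0)
  obtain ⟨n₁, hn₁def⟩ : ∃ n₁, n₁ = k ^ (e + T) * (U + 1) + W := ⟨_, rfl⟩
  have hn₁ : t n₁ = c₀ := by
    have := hblock 0 hkT
    rw [hn₁def]
    simpa using this
  have hn₁pos : 0 < n₁ := by
    have : 0 < k ^ (e + T) * (U + 1) := Nat.mul_pos (pow_pos hk0 _) (Nat.succ_pos U)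
    omega
  obtain ⟨g, hgdef⟩ : ∃ g, g = p * n₁ := ⟨_, rfl⟩
  have hg1 : 1 ≤ g := hgdef ▸ Nat.mul_pos hp.pos hn₁pos
  have hu₀ : 1 ≤ U + 1 := by omega
  obtain ⟨y, hydef⟩ : ∃ y, y = 16 * g * (k ^ e) ^ 2 * (U + 1) := ⟨_, rfl⟩
  obtain ⟨X, hXdef⟩ : ∃ X, X = k ^ (e + (T + y * P)) := ⟨_, rfl⟩
  have hX : 16 * g * (k ^ e) ^ 2 * (U + 1) ≤ X := by
    have h1 : y ≤ e + (T + y * P) := by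
      have : y * 1 ≤ y * P := Nat.mul_le_mul_left y hP
      omega
    have h2 : e + (T + y * P) < X := hXdef ▸ Nat.lt_pow_self hk1
    omega
  obtain ⟨s, hsmod, hlo, hhi⟩ := exists_sq_between g (k ^ e) (U + 1) X hg1 (by omega) hu₀ hX
  have h1m : 1 % k ^ e = 1 := Nat.mod_eq_of_lt (by omega)
  have hs0 : s ≠ 0 := by
    intro h0
    rw [h0, Nat.zero_mod, h1m] at hsmod
    exact absurd hsmod (by norm_num)
  -- congruences modulo `k ^ e`
  have hXm : X = k ^ e * k ^ (T + y * P) := by rw [hXdef, pow_add]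
  have hn₁mod : n₁ ≡ W [MOD k ^ e] := by
    have : n₁ = W + k ^ e * (k ^ T * (U + 1)) := by rw [hn₁def, pow_add]; ring
    rw [this]
    exact Nat.add_mul_mod_self_left W (k ^ e) _
  have hsmod' : s ≡ 1 [MOD k ^ e] := hsmod
  have hg2 : g * s ^ 2 ≡ W [MOD k ^ e] := by
    have := (hpmod.mul hn₁mod).mul (hsmod'.pow 2)
    rw [hgdef]
    simpa using this
  -- `g s² = (U+1) X + R` with `R = k^e j + W`, `j < k^(T + yP)`
  obtain ⟨R, hR⟩ := Nat.exists_eq_add_of_le hlo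
  have hRX : R < X := by
    have : (U + 1 + 1) * X = (U + 1) * X + X := by ring
    omega
  have hRmod : R % k ^ e = W := by
    have h1 : ((U + 1) * X + R) % k ^ e = W % k ^ e := by rw [← hR]; exact hg2
    rw [hXm, show (U + 1) * (k ^ e * k ^ (T + y * P)) + R
        = R + k ^ e * ((U + 1) * k ^ (T + y * P)) by ring, Nat.add_mul_mod_self_left] at h1
    rw [h1, Nat.mod_eq_of_lt hW]
  obtain ⟨j, hjdef⟩ : ∃ j, j = R / k ^ e := ⟨_, rfl⟩
  have hRj : R = k ^ e * j + W := by
    have := Nat.div_add_mod R (k ^ e)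
    rw [hRmod, ← hjdef] at this
    exact this.symm
  have hj : j < k ^ (T + y * P) := by
    have h1 : k ^ e * j < k ^ e * k ^ (T + y * P) := by
      calc k ^ e * j ≤ k ^ e * j + W := Nat.le_add_right _ _
        _ = R := hRj.symm
        _ < X := hRX
        _ = k ^ e * k ^ (T + y * P) := hXm
    exact Nat.lt_of_mul_lt_mul_left h1
  -- the value of `t(g s²)` from pumping …
  have hval : t (g * s ^ 2) = c₀ := by
    have h := hpump y j hj
    rw [← hXdef] at h
    have e1 : X * (U + 1) + (k ^ e * j + W) = g * s ^ 2 := by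
      rw [hR, hRj]; ring
    rw [e1] at h
    exact h
  -- … and from complete multiplicativity
  have hval' : t (g * s ^ 2) = -c₀ := by
    rw [hgdef, hmul, hmul, hprime p hp, hn₁, hsq s hs0]
    ring
  rw [hval] at hval'
  have : c₀ = 0 := by omega
  exact hc₀ this

/-- The hypotheses of `not_isKAutomatic_of_apply_prime` hold for Liouville's `λ`
(`λ n = (-1)^{Ω(n)}` for `n ≠ 0`, `λ 0 = 0`, `λ` completely multiplicative). [folklore] -/
theorem liouville_trichotomy (n : ℕ) :
    (ArithmeticFunction.liouville n : ℤ) = 1 ∨ ArithmeticFunction.liouville n = -1 ∨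
      ArithmeticFunction.liouville n = 0 := by
  by_cases hn : n = 0
  · simp [hn]
  · rw [ArithmeticFunction.liouville_apply hn]
    rcases neg_one_pow_eq_or ℤ (ArithmeticFunction.cardFactors n) with h | h
    · exact Or.inl h
    · exact Or.inr (Or.inl h)

end CoonsLiouville

/-- **Coons 2010, Theorem 1.5 (first clause), discharged**: Liouville's function `λ` is not
`k`-automatic for any `k ≥ 2`, i.e. its `k`-kernel is infinite. The formal proof is the
elementary one of this file (van der Waerden + complete multiplicativity + digit pumping +
primes `≡ 1 (mod k^e)`), not Coons's analytic argument. [cite: Coons2011, Theorem 1.5] -/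
theorem coons_liouville_not_automatic_holds : coons_liouville_not_automatic :=
  fun _k hk => CoonsLiouville.not_isKAutomatic_of_apply_prime hk
    CoonsLiouville.liouville_trichotomy
    (fun _n hn => ArithmeticFunction.liouville_ne_zero hn)
    ArithmeticFunction.liouville_apply_mul
    (fun _p hp => by
      rw [ArithmeticFunction.liouville_apply hp.ne_zero,
        ArithmeticFunction.cardFactors_apply_prime hp, pow_one])

end Literature.NumberTheory.LFunctions

/-!
# Part 3. `(Ω(n) mod 2)` is not `2`-automatic (Coons 2010, Corollary 1.7) — discharged

Appended 2026-08-15 (independent of the proofs above except through their results): the named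
fact `Literature.NumberTheory.LFunctions.coons_Omega_mod_two_not_automatic` (M. Coons,
*(Non)Automaticity of number theoretic functions*, J. Théor. Nombres Bordeaux **22** (2010)
339–352, Corollary 1.7, first clause: "The function `(Ω(n) mod 2)` is not `2`-automatic") follows
from Theorem 1.5 (`coons_liouville_not_automatic_holds`, Part 2) exactly as in the paper —
`(Ω(n) mod 2) = (1 - λ(n))/2` and Lemma 1.6 — an implication already proved in the statement
file as `coons_Omega_mod_two_not_automatic_of_liouville`. [Coons2011]
-/

namespace Literature.NumberTheory.LFunctions

/-- **Coons 2010, Corollary 1.7 (first clause), discharged**: the sequence `(Ω(n) mod 2)_{n ≥ 0}`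
(`Ω = ArithmeticFunction.cardFactors`) is not `2`-automatic, i.e. its `2`-kernel is infinite.
Proof as printed: Theorem 1.5 (`coons_liouville_not_automatic_holds`) and Lemma 1.6, via the
reduction `coons_Omega_mod_two_not_automatic_of_liouville` of the statement file.
[cite: Coons2011, Corollary 1.7] -/
theorem coons_Omega_mod_two_not_automatic_holds : coons_Omega_mod_two_not_automatic :=
  coons_Omega_mod_two_not_automatic_of_liouville coons_liouville_not_automatic_holds

end Literature.NumberTheory.LFunctions
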